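import Literature.Probability.Percolation.ArmSeparationExclusionInner
import Literature.Probability.Percolation.ArmSeparationIntFrame
import Literature.Probability.Percolation.ArmSeparationRawGoodUp
import HarnessLib

/-!
# Raw success of a term at an INTERNAL extremity (twin of `ArmSeparationRawGood.lean`)

Topic `Literature/Probability/Percolation`; family `crit-perc` / near-critical percolation on `𝕋`.
The first brick of the INNER half of the near-critical arm-separation theorem for four arms in the
ADJACENT colour arrangement (P. Nolin, EJP 13 (2008), Thm. 11, `j = 4`, `σ = BBWW`
[arXiv 0711.4948: Thm. 10], §4.4, "2. Internal extremities: the reasoning is the same"): the raw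
success event of the fence of a term of the exploration of the inner half-annulus
`HalfAnnulus.intDom m` (`TriHalfAnnulus.lean`; tips on the inner side `x₀ = m` of `∂Λ_m`), the
word-for-word twin of `TrapRawOK` with `(intDom m).lower` in place of `(trapDomain M).lower`:

* `IntRawOK m c z k ω` — some configuration agreeing with `ω` off `lower c z` lies in
  `trapRSW₃ z k` (two open frames and two closed rings about the tip);
* its consequences: `IntRawOK.outer_ring`, `IntRawOK.inner_ring`, `IntRawOK.not_pathIn_of_subset`
  (no open path off `lower c z` across the closed rings — domain independent), `IntRawOK.no_escape`
  (no closed escape from top-type sites near the tip, `int_no_closed_escape`), `IntRawOK.exists_fence`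
  (the fence INSIDE `Λ_m` joined to the term, `int_exists_fence`);
* `IntSeqFailRaw m u k₀ K` — raw failure of the `u`-th term on all scales; `IntNoRSW₃`,
  `intNoRSW₃_of_failRaw`, `exists_intRawOK_of_not_failRaw`.

Everything here is proved; no named facts are introduced.

## References

* P. Nolin, Near-critical percolation in two dimensions, *Electron. J. Probab.* 13 (2008), §4.4
  Lemma 15 and the internal extremities (arXiv 0711.4948: Lemma 14; proof of Thm. 10, p. 13) [Nolin2008].
* H. Kesten, Scaling relations for 2D-percolation, *Comm. Math. Phys.* 109 (1987), Lemma 2 [Kesten1987].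
-/

noncomputable section

open Set

namespace Literature.Probability.Percolation

open LatticeModels HalfAnnulus

/-! ### The raw success event of a term -/

/-- **Raw success of the fence of `c` (tip `z`) at scale `k`, internal extremity**: some
configuration agreeing with `ω` off `(intDom m).lower c z` lies in `trapRSW₃ z k`. [cite: Nolin2008, §4.4 Lemma 15 (proof), internal extremities (arXiv 0711.4948: Lemma 14, Thm. 10 p. 13)] -/
def IntRawOK (m : ℕ) (c : Finset (Site 2)) (z : Site 2) (k : ℕ) (ω : SiteConfig (Site 2)) : Prop :=
  ∃ ω' : SiteConfig (Site 2), (∀ v, v ∉ (intDom m).lower c z → (v ∈ ω' ↔ v ∈ ω)) ∧ ω' ∈ trapRSW₃ z k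

namespace IntRawOK

variable {m k : ℕ} {c : Finset (Site 2)} {z : Site 2} {ω : SiteConfig (Site 2)}

/-- **The fence from raw success** (`m ≥ 5`, `1 ≤ k`, tip at distance `> 2k` from both ends of
the side): an open vertical crossing of the corner box `[m-2k, m-k] × [z₁+k, z₁+2k]` INSIDE `Λ_m`
through a site `mm`, joined to a site of `c` by an open path of the inner zone. [cite: Nolin2008, §4.4 Lemma 15 (proof), internal extremities (arXiv 0711.4948: Lemma 14)] [cite: Kesten1987, Lemma 2] -/
theorem exists_fence (h : IntRawOK m c z k ω) (hm : 5 ≤ m) (hk : 1 ≤ k) (hc : (intDom m).IsCrossing c z)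
    (htk : -(m : ℤ) + 2 * k + 1 ≤ z 1 ∧ z 1 ≤ -(2 * (k : ℤ) + 1)) (hcω : (↑c : Set (Site 2)) ⊆ ω) :
    ∃ mm : Site 2, OpenVCrossThrough (triStrip (z 0 - 2 * k) (z 1 + k) k k) (z 1 + k) (z 1 + 2 * k) ω mm ∧
      ∃ s ∈ c, PathIn triGraph (intFrameZone m z k ∩ ω) s mm := by
  obtain ⟨ω', hagree, hω'⟩ := h
  exact int_exists_fence hm hk hc htk hcω hagree hω'.1.1.1

/-- **Protection** from raw success: no closed path of the half-annulus from a top-type site in the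
`8k`-box about `z` to outside the `16k`-box (`1 ≤ k`, `c` open). [cite: Nolin2008, §4.4 Lemma 15 (proof), internal extremities (arXiv 0711.4948: Lemma 14)] -/
theorem no_escape (h : IntRawOK m c z k ω) (hk : 1 ≤ k) (hc : (intDom m).IsCrossing c z)
    (hcω : (↑c : Set (Site 2)) ⊆ ω) {q t : Site 2} (hq : q ∈ (intDom m).Tp ∪ (intDom m).Jabove z)
    (hqin : z 0 - 8 * k ≤ q 0 ∧ q 0 ≤ z 0 + 8 * k ∧ z 1 - 8 * k ≤ q 1 ∧ q 1 ≤ z 1 + 8 * k)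
    (ht : t 0 ≤ z 0 - 16 * k ∨ z 0 + 16 * k ≤ t 0 ∨ t 1 ≤ z 1 - 16 * k ∨ z 1 + 16 * k ≤ t 1) :
    ¬ PathIn triGraph (haSet m ∩ ωᶜ) q t := by
  obtain ⟨ω', hagree, hω'⟩ := h
  intro hpath
  refine int_no_closed_escape (k := 8 * k) (by omega) hc hcω hagree hω'.1.1.2 hq ?_ ?_ hpath
  · push_cast; omega
  · push_cast; omega

/-- **Outer exclusion** from raw success: no open path off `lower c z` from the `17k`-box about
`z` to outside the `31k`-box (`1 ≤ k`). [cite: Nolin2008, §4.4 Lemma 15 (proof) (arXiv 0711.4948: Lemma 14)] -/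
theorem outer_ring (h : IntRawOK m c z k ω) (hk : 1 ≤ k) {s t : Site 2}
    (hs : z 0 - 17 * k ≤ s 0 ∧ s 0 ≤ z 0 + 17 * k ∧ z 1 - 17 * k ≤ s 1 ∧ s 1 ≤ z 1 + 17 * k)
    (ht : t 0 ≤ z 0 - 31 * k ∨ z 0 + 31 * k ≤ t 0 ∨ t 1 ≤ z 1 - 31 * k ∨ z 1 + 31 * k ≤ t 1) :
    ¬ PathIn triGraph ((↑((intDom m).lower c z) : Set (Site 2))ᶜ ∩ ω) s t := by
  obtain ⟨ω', hagree, hω'⟩ := h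
  refine not_pathIn_of_closed_ring hk (L := ↑((intDom m).lower c z)) (fun v hv => hagree v ?_) ?_ subset_rfl hs ht
  · exact fun h => hv (Finset.mem_coe.2 h)
  · have : ω'ᶜ ∈ triRingAt z k := hω'.1.2
    exact this

/-- **Inner exclusion** from raw success: no open path off `lower c z` from the `3k`-box about
`z` to outside the `7k`-box (`1 ≤ k`). [cite: Nolin2008, §4.4 Lemma 15 (proof) (arXiv 0711.4948: Lemma 14)] -/
theorem inner_ring (h : IntRawOK m c z k ω) (hk : 1 ≤ k) {s t : Site 2}
    (hs : z 0 - 3 * k ≤ s 0 ∧ s 0 ≤ z 0 + 3 * k ∧ z 1 - 3 * k ≤ s 1 ∧ s 1 ≤ z 1 + 3 * k)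
    (ht : t 0 ≤ z 0 - 7 * k ∨ z 0 + 7 * k ≤ t 0 ∨ t 1 ≤ z 1 - 7 * k ∨ z 1 + 7 * k ≤ t 1) :
    ¬ PathIn triGraph ((↑((intDom m).lower c z) : Set (Site 2))ᶜ ∩ ω) s t := by
  obtain ⟨ω', hagree, hω'⟩ := h
  refine not_pathIn_of_closed_innerRing hk (L := ↑((intDom m).lower c z)) (fun v hv => hagree v ?_) ?_ subset_rfl hs ht
  · exact fun h => hv (Finset.mem_coe.2 h)
  · have : ω'ᶜ ∈ triInnerRingAt z k := hω'.2
    exact this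

/-- The exclusions for open sets known to avoid `lower c z`. [folklore] -/
theorem not_pathIn_of_subset (h : IntRawOK m c z k ω) (hk : 1 ≤ k) {A : Set (Site 2)}
    (hA : A ⊆ ((↑((intDom m).lower c z) : Set (Site 2))ᶜ ∩ ω)) {s t : Site 2}
    (hs : z 0 - 3 * k ≤ s 0 ∧ s 0 ≤ z 0 + 3 * k ∧ z 1 - 3 * k ≤ s 1 ∧ s 1 ≤ z 1 + 3 * k)
    (ht : t 0 ≤ z 0 - 7 * k ∨ z 0 + 7 * k ≤ t 0 ∨ t 1 ≤ z 1 - 7 * k ∨ z 1 + 7 * k ≤ t 1) :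
    ¬ PathIn triGraph A s t := fun hp => h.inner_ring hk hs ht (hp.mono hA)

end IntRawOK

/-! ### Raw failure of a term -/

/-- **Raw failure of the `u`-th term of the inner exploration**: the term exists and is raw-bad on
all the scales `k_j = k₀ · 32^j`, `j < K`. [cite: Nolin2008, §4.4 Lemma 15 (proof), internal extremities (arXiv 0711.4948: Lemma 14)] -/
def IntSeqFailRaw (m u k₀ K : ℕ) (ω : SiteConfig (Site 2)) : Prop :=
  ∃ c z, (intDom m).lowestSeq ω u = some (c, z) ∧ ∀ j < K, ¬ IntRawOK m c z (trapScale k₀ j) ω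

/-- **No RSW₃ event off `lower c z` at any scale.** [cite: Nolin2008, §4.4 Lemma 15 (proof) (arXiv 0711.4948: Lemma 14)] -/
def IntNoRSW₃ (m : ℕ) (c : Finset (Site 2)) (z : Site 2) (k₀ K : ℕ) (ω : SiteConfig (Site 2)) : Prop :=
  ∀ j < K, ∀ ω' : SiteConfig (Site 2), (∀ v, v ∉ (intDom m).lower c z → (v ∈ ω' ↔ v ∈ ω)) →
    ω' ∉ trapRSW₃ z (trapScale k₀ j)

/-- Raw failure is exactly `IntNoRSW₃` for the term. [folklore] -/
theorem intNoRSW₃_of_failRaw {m k₀ K : ℕ} {c : Finset (Site 2)} {z : Site 2} {ω : SiteConfig (Site 2)}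
    (hfail : ∀ j < K, ¬ IntRawOK m c z (trapScale k₀ j) ω) : IntNoRSW₃ m c z k₀ K ω :=
  fun j hj ω' hagree hω' => hfail j hj ⟨ω', hagree, hω'⟩

/-- `IntNoRSW₃` is the standard `TrapNoRSWL` with the frozen set `lower c z`. [folklore] -/
theorem intNoRSW₃_iff_trapNoRSWL {m k₀ K : ℕ} {c : Finset (Site 2)} {z : Site 2} {ω : SiteConfig (Site 2)} :
    IntNoRSW₃ m c z k₀ K ω ↔ TrapNoRSWL ((intDom m).lower c z) z k₀ K ω := Iff.rfl

/-- **On the complement of raw failure every term is raw-good on some scale.** [folklore] -/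
theorem exists_intRawOK_of_not_failRaw {m u k₀ K : ℕ} {c : Finset (Site 2)} {z : Site 2} {ω : SiteConfig (Site 2)}
    (h : ¬ IntSeqFailRaw m u k₀ K ω) (hu : (intDom m).lowestSeq ω u = some (c, z)) : ∃ j < K, IntRawOK m c z (trapScale k₀ j) ω := by
  by_contra hno
  push Not at hno
  exact h ⟨c, z, hu, fun j hj hok => hno j hj hok⟩

end Literature.Probability.Percolation
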